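import Summits.BirchSwinnertonDyer.BirchSwinnertonDyer.Theorems.SignedBaseChangeAnticyclotomicEisensteinDivisibilityAdmdefSignedEquiv
import Summits.BirchSwinnertonDyer.BirchSwinnertonDyer.Theorems.SignedBaseChangeAnticyclotomicEisensteinDivisibilityAdmdefChebSplitTarget
import Summits.BirchSwinnertonDyer.BirchSwinnertonDyer.Theorems.AdditiveKolyvaginRoadCheb
import HarnessLib

/-!
# Line `admdef`, cell β (`p` SPLIT in `K`): the SIGNED ČEBOTAREV SUPPLY (Sup±) of Bertolini–Darmon admissible primes, IN KERNEL
# (crux `AnticyclotomicEisensteinDivisibility`, stmt-BirchSwinnertonDyer-20727; LEAD seat bsd-line-sbc-p1 gen 18,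
# `--supports stmt-BirchSwinnertonDyer-20727`)

WHY THIS FILE.  Skeleton v9 of `Cruxes/AnticyclotomicEisensteinDivisibility/Lines/admdef.lean` (LEAD gen 17, crux idea «signdetour» of bsd-idea-5 g23)
runs W. Zhang's Selmer-killing walk on cell β with a SIGNED two-prime detour, which consumes (Sup±) `Signdetour.SignedSupplyAt W K p c`: for each
sign `s` and each finite set `B₀` of admissible primes, an admissible `q ∉ B₀` on whose local cohomology `H¹(K_v, E[p])`, `v ∣ q`, complex conjugation
acts by `sgnP s`.  v9 obtains (Sup±) from the PRINT stub (Eig±) `stub_eigenSupply` (a non-zero `s`-eigenclass of `H¹(K, E[p])`, to which the LEAD's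
Čebotarev-with-a-class `…AdmdefChebSplit.exists_admissible_loc_ne_zero_of_target` is applied).  THIS FILE proves (Sup±) on cell β WITHOUT any class:
Čebotarev in `K(E[p])/ℚ` applied to the admissible TARGET `c₀ · res g₁ ∼ diag(ν, 2ν)` (`…AdmdefChebSplitTarget.exists_admissible_target_of_split`,
`ν = sgnP s`) yields primes `ℓ ∉ B₀`, inert in `K`, with `ρ̄(Frob_ℓ) ∼ diag(ν, 2ν)`, hence `ℓ ≡ 2`, `a_ℓ ≡ 3ν (mod p)` — BD-admissible WITH THE
CONGRUENCE `p ∣ ℓ + 1 − ν a_ℓ` — and `…AdmdefSignedEquiv.localEquiv_of_admQ_of_dvd` (W. Zhang (9.2) with the sign exported) turns that congruence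
into the (Equiv)-sign `s`.  So `stub_eigenSupply` can be DROPPED from the skeleton (v10): (Sup±) is kernel on cell β.

WHAT IS PROVED (kernel; no definition, no named fact, no `sorry`):
* `dvd_signedCongruence_of_frob` — the prime `ℓ` below an arithmetic Frobenius acting on `E(ℚ̄)[p]` as `diag(ν, 2ν)` satisfies
  `p ∣ ℓ + 1 − ν a_ℓ(E)` (`det = ℓ ≡ 2`, `tr = a_ℓ ≡ 3ν`; the computation of `AdditiveKoly.Cheb.isAdmissible_congruences_of_frob` with the sign kept).
* `exists_admissible_dvd_of_target` — class-free Čebotarev FROM THE TARGET: `K` imaginary quadratic, `c ≠ 1`, `p ≥ 5`, the admissible target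
  available for `(c, ν)` ⟹ for every finite `B₀ ⊂ ℕ` an admissible `q ∉ B₀` with `p ∣ q + 1 − ν a_q(E)` (Steps A, C–F, H of the AKR proof of
  `AdditiveKoly.Cheb.exists_admissible_loc_ne_zero`, the class-dependent Steps B, G dropped).
* `signedSupply_of_split` — **(Sup±) on cell β** (`p ≥ 5`, `ρ̄_{E,p}` onto, `K` imaginary quadratic, `N_E` Heegner in `K`, `p` split, `c ≠ 1`):
  `∀ s B₀, ∃ q : AdmQ W K p, q ∉ B₀ ∧ ∀ v ∋ q, ∀ z, loc_v (c_* z) = sgnP s • loc_v z` — the text of `Signdetour.SignedSupplyAt W K p c` unfolded.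

HONEST FRAMING: a class-free re-run of the AKR cell's Čebotarev argument (lead `bsd-wall-akr-p1` g2; koly g13's template) plus the LEAD's g17/g18
ports; nothing about Heegner points, (Anch±), the BRIDGE or the crux is asserted.  BSD is not proved by this file.

References: [cite: WZhang2014, Lemma 7.3, §9 (9.2), Notations (xiv)] [cite: BertoliniDarmon2005, Thm. 3.2, p. 18] [cite: GrossLMS1991, §9 Prop. 9.1]
[cite: Serre1981, §8.1 eq. (238)] [cite: DarmonDiamondTaylor1995, Prop. 2.8 (a)] [cite: TateGCFT1967, §2.4].
-/

-- D-0017: single-problem summit, the namespace repeats the problem name by design.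
set_option linter.dupNamespace false
set_option autoImplicit false

noncomputable section

open scoped Classical Pointwise
open Polynomial

namespace Summit.BirchSwinnertonDyer.BirchSwinnertonDyer.Theorems.SignedBaseChangeAcDivAdmdefSignedSupply

open WeierstrassCurve Field Function NumberField IsDedekindDomain Rat.HeightOneSpectrum
open Literature.NumberTheory.EllipticCurves Literature.NumberTheory.GaloisRepresentations Module
open Summit.BirchSwinnertonDyer.BirchSwinnertonDyer.Theorems
open Summit.BirchSwinnertonDyer.BirchSwinnertonDyer.Theorems.AdditiveKoly
open Summit.BirchSwinnertonDyer.BirchSwinnertonDyer.Theorems.AdditiveKoly.Cheb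
open Summit.BirchSwinnertonDyer.Rank1Residual.X11b.Three.Koly.Method2

/-! ## §1 The signed congruence of the prime below a Frobenius of the target shape -/

section Congruence

variable (W : WeierstrassCurve ℚ) [W.IsElliptic] [W.IsGloballyMinimal]

/-- **The prime below a Frobenius of the target shape satisfies the SIGNED admissibility congruence.**  If `γ ∈ Γ_ℚ` is an arithmetic
Frobenius above the good prime `ℓ ≠ p` of `E = W/ℚ` (global minimal form) acting on `E(ℚ̄)[p]`, read through an additive frame `e`, as
`diag(ν, 2ν)` (`ν = ±1`), then `p ∣ ℓ + 1 − ν a_ℓ`: on the `𝔽_p`-plane `E[p]`, `det ρ̄(γ) = ℓ`, `tr ρ̄(γ) = a_ℓ`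
(`det_galoisRepTorsion_frobenius_eq`, `trace_galoisRepTorsion_frobenius_eq`), and `ρ̄(γ)² = 3ν ρ̄(γ) − 2` with `ρ̄(γ)` non-scalar gives
`det = 2`, `tr = 3ν` (`AdditiveKoly.Cheb.trace_det_of_quadratic`), so `ℓ + 1 − ν a_ℓ ≡ 3 − 3ν² = 0`.  The computation of
`AdditiveKoly.Cheb.isAdmissible_congruences_of_frob` verbatim, its last step keeping the sign.
[cite: Serre1981, §8.1 eq. (238)] [cite: DarmonDiamondTaylor1995, Prop. 2.8 (a)] [cite: BertoliniDarmon2005, p. 18] -/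
theorem dvd_signedCongruence_of_frob {p : ℕ} [Fact p.Prime] {ℓ : ℕ} [Fact ℓ.Prime] (hℓp : ℓ ≠ p)
    (hgood : W.HasGoodReductionAtPrime ℓ) {v : HeightOneSpectrum (𝓞 ℚ)} (hv : (primesEquiv v : ℕ) = ℓ)
    {𝔓 : Ideal (absIntegers (𝓞 ℚ) ℚ)} (h𝔓 : 𝔓 ∈ v.primesAbove)
    {γ : absoluteGaloisGroup ℚ} (hγ : IsArithFrobAt (𝓞 ℚ) γ 𝔓)
    (e : geomTorsion W (p : ℤ) ≃+ (Fin 2 → ZMod p)) {ν : ℤ} (hν : ν = 1 ∨ ν = -1)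
    (hact : ∀ P, e (γ • P) = ![(ν : ZMod p) * e P 0, (ν : ZMod p) * 2 * e P 1]) :
    (p : ℤ) ∣ (ℓ : ℤ) + 1 - ν * W.frobeniusTrace ℓ := by
  -- adapted from Theorems/AdditiveKolyvaginRoadChebTarget.lean `isAdmissible_congruences_of_frob`
  have hp : p.Prime := Fact.out
  letI : Module (ZMod p) (geomTorsion W (p : ℤ)) := AddSubgroup.torsionBy.zmodModule
  set f := (galoisRepTorsion W p γ).toAdd.toAddMonoidHom.toZModLinearMap p with hfdef
  have hf : ∀ Q : geomTorsion W (p : ℤ), f Q = γ • Q := fun Q => rfl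
  have htr : LinearMap.trace (ZMod p) _ f = (W.frobeniusTrace ℓ : ZMod p) :=
    W.trace_galoisRepTorsion_frobenius_eq p hℓp hgood hv h𝔓 hγ
  have hdet : LinearMap.det f = (ℓ : ZMod p) := W.det_galoisRepTorsion_frobenius_eq p hℓp hgood hv h𝔓 hγ
  have h2 : Module.finrank (ZMod p) (geomTorsion W (p : ℤ)) = 2 :=
    Literature.RepresentationTheory.FiniteGroups.Representation.finrank_eq_two_of_natCard_eq_sq
      (card_torsionPoints_eq_sq_holds W (AlgebraicClosure ℚ) (n := p) (by exact_mod_cast hp.ne_zero))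
  haveI : FiniteDimensional (ZMod p) (geomTorsion W (p : ℤ)) := Module.finite_of_finrank_eq_succ h2
  have hννk : (ν : ZMod p) * (ν : ZMod p) = 1 := by
    have hνν : ν * ν = 1 := by rcases hν with rfl | rfl <;> norm_num
    rw [← Int.cast_mul, hνν, Int.cast_one]
  -- the linear map underlying `e` (a `ℤ/p`-additive map is linear)
  set eL : geomTorsion W (p : ℤ) →ₗ[ZMod p] (Fin 2 → ZMod p) := e.toAddMonoidHom.toZModLinearMap p with heL
  have heL' : ∀ Q, eL Q = e Q := fun Q ↦ rfl
  -- `f² = 3ν f − 2` on `E[p]`, read through `e`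
  have hsq : ∀ Q, f (f Q) = ((3 : ZMod p) * (ν : ZMod p)) • f Q - (2 : ZMod p) • Q := fun Q ↦ by
    apply e.injective
    have hlin : ∀ (c : ZMod p) (R : geomTorsion W (p : ℤ)), e (c • R) = c • e R := fun c R ↦ by
      rw [← heL', map_smul, heL']
    rw [hf, hf, hact, hact, map_sub, hlin, hlin, hact]
    ext i
    fin_cases i
    · simp only [Fin.zero_eta, Fin.isValue, Matrix.cons_val_zero, Pi.sub_apply, Pi.smul_apply, smul_eq_mul]
      linear_combination (-2 * e Q 0) * hννk
    · simp only [Fin.mk_one, Fin.isValue, Matrix.cons_val_one, Matrix.cons_val_zero, Pi.sub_apply, Pi.smul_apply,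
        smul_eq_mul]
      linear_combination (-2 * e Q 1) * hννk
  -- `f` is not a scalar: `f e⁻¹(1,0) = ν e⁻¹(1,0)` and `f e⁻¹(0,1) = 2ν e⁻¹(0,1)`, `ν ≠ 2ν`
  have hne : ∀ c : ZMod p, ∃ Q, f Q ≠ c • Q := by
    intro c
    by_contra hall
    push Not at hall
    have h0 := congrArg (fun v ↦ v 0) (congrArg e (hall (e.symm ![1, 0])))
    have h1 := congrArg (fun v ↦ v 1) (congrArg e (hall (e.symm ![0, 1])))
    simp only [hf, hact, ← heL', map_smul] at h0 h1
    simp only [heL', AddEquiv.apply_symm_apply, Matrix.cons_val_zero, Matrix.cons_val_one, Pi.smul_apply,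
      smul_eq_mul, mul_one, mul_zero] at h0 h1
    -- `ν = c` and `2ν = c`
    rw [← h0] at h1
    have : (ν : ZMod p) * 2 - (ν : ZMod p) = 0 := by rw [h1, sub_self]
    have hν0 : (ν : ZMod p) ≠ 0 := fun h ↦ by rw [h, zero_mul] at hννk; exact zero_ne_one hννk
    have h3 : (ν : ZMod p) * (2 - 1) = 0 := by rw [mul_sub, mul_one]; exact this
    rcases mul_eq_zero.mp h3 with h4 | h4
    · exact hν0 h4
    · exact one_ne_zero (by linear_combination h4 : (1 : ZMod p) = 0)
  obtain ⟨htr', hdet'⟩ := trace_det_of_quadratic h2 f _ _ hsq hne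
  -- `ℓ ≡ 2`, `a_ℓ ≡ 3ν`, hence `ℓ + 1 − ν a_ℓ ≡ 3 − 3ν² = 0`
  have hℓ2 : (ℓ : ZMod p) = 2 := hdet.symm.trans hdet'
  have ha3 : (W.frobeniusTrace ℓ : ZMod p) = 3 * (ν : ZMod p) := htr.symm.trans htr'
  apply (ZMod.intCast_zmod_eq_zero_iff_dvd _ p).mp
  push_cast
  rw [hℓ2, ha3]
  linear_combination (-3 : ZMod p) * hννk

end Congruence

/-! ## §2 Class-free Čebotarev with the sign, from the admissible target -/

section Cheb

variable (W : WeierstrassCurve ℚ) (K : Type) [Field K] [NumberField K] [W.IsElliptic] [W.IsGloballyMinimal]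

set_option maxHeartbeats 800000 in
-- (same budget as the AKR original `AdditiveKoly.Cheb.exists_admissible_loc_ne_zero`, whose Steps A, C–F, H this is)
/-- **Class-free Čebotarev with the sign, FROM THE ADMISSIBLE TARGET.**  For `E = W/ℚ` in global minimal form, `p ≥ 5`, `K` imaginary
quadratic with complex conjugation `c ≠ 1`, a sign `ν = ±1`, and the ADMISSIBLE TARGET available for `(c, ν)` — `htarget`: for every `c₀ ∈ Γ_ℚ`
whose transport `t` lifts `c` involutively, some `g₁ ∈ Γ_K` and additive frame `e : E(K̄)[p] ≃ 𝔽_p²` with `e (T (g₁ Q)) = (ν (e Q)₀, 2ν (e Q)₁)` and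
`c₀ · res g₁` acting on `E(ℚ̄)[p]` the same way (the conclusion of `…AdmdefChebSplitTarget.exists_admissible_target_of_ramifiedPrime`) — and a
finite set `B₀ ⊂ ℕ`: there is a Bertolini–Darmon `1`-admissible prime `q ∉ B₀` WITH THE CONGRUENCE `p ∣ q + 1 − ν a_q(E)`.  Proof: Čebotarev
(`absoluteGaloisGroup.frobenius_dense`, from the PROVED `chebotarev_artinRep_holds`) gives an arithmetic Frobenius `γ = c₀ · res(g₁ m)`, `m ∈ Γ_{K(E[p])}`,
at a prime of `\bar ℤ` outside a finite bad set; the prime `ℓ` below is unramified, good, `≠ p`, `∉ B₀`, INERT in `K` (`c₀ · res(g₁ m) ∉ res Γ_K`,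
`exists_place_inert_of_not_mem_range`), and `γ` acts on `E(ℚ̄)[p]` as `diag(ν, 2ν)`, whence the admissibility congruences
(`isAdmissible_congruences_of_frob`) and the signed one (§1).  [cite: WZhang2014, Lemma 7.3] [cite: BertoliniDarmon2005, Thm. 3.2]
[cite: TateGCFT1967, §2.4] -/
theorem exists_admissible_dvd_of_target {p : ℕ} [Fact p.Prime] (h5 : 5 ≤ p) (hK : IsImaginaryQuadratic K)
    {c : K ≃ₐ[ℚ] K} (hc1 : c ≠ 1) {ν : ℤ} (hν : ν = 1 ∨ ν = -1)
    (htarget : ∀ {c₀ : absoluteGaloisGroup ℚ}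
      (ht : IsLiftOfAut c (absGaloisTransport (K := ℚ) (L := K) c₀).toRingEquiv),
      (∀ x, (absGaloisTransport (K := ℚ) (L := K) c₀).toRingEquiv
        ((absGaloisTransport (K := ℚ) (L := K) c₀).toRingEquiv x) = x) →
      ∃ (g₁ : absoluteGaloisGroup K) (e : geomTorsion (W.baseChange K) (p : ℤ) ≃+ (Fin 2 → ZMod p)),
        (∀ Q, e (ht.torsionMap W (p : ℤ) (g₁ • Q)) = ![(ν : ZMod p) * e Q 0, (ν : ZMod p) * 2 * e Q 1]) ∧
        (∀ P : geomTorsion W (p : ℤ),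
          e (RatClosure.torsionEquiv (K := K) W (p : ℤ) ((c₀ * absGaloisRestrict ℚ K g₁) • P)) =
            ![(ν : ZMod p) * e (RatClosure.torsionEquiv (K := K) W (p : ℤ) P) 0,
              (ν : ZMod p) * 2 * e (RatClosure.torsionEquiv (K := K) W (p : ℤ) P) 1]))
    (B₀ : Finset ℕ) :
    ∃ q : ℕ, q ∉ B₀ ∧ BertoliniDarmon2005.IsAdmissiblePrime (W.conductorNorm ℤ) K (fun ℓ ↦ W.frobeniusTrace ℓ) p 1 q ∧
      (p : ℤ) ∣ (q : ℤ) + 1 - ν * W.frobeniusTrace q := by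
  -- adapted from Theorems/AdditiveKolyvaginRoadCheb.lean `exists_admissible_loc_ne_zero`, Steps A, C–F, H (no class: Steps B, G dropped)
  classical
  have hp : p.Prime := Fact.out
  haveI : Algebra.IsQuadraticExtension ℚ K := ⟨hK.1⟩
  haveI : IsTotallyComplex K := hK.2
  have hn0 : ((p : ℕ) : ℤ) ≠ 0 := by exact_mod_cast hp.ne_zero
  -- ### Step A: complex conjugation, the involutive lift, the admissible target
  obtain ⟨c₀, hc₀⟩ := exists_isComplexConjugation (Rat.castHom ℝ)
  set t : AlgebraicClosure K ≃+* AlgebraicClosure K :=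
    (absGaloisTransport (K := ℚ) (L := K) c₀).toRingEquiv with ht_def
  have ht : IsLiftOfAut c t :=
    RatClosure.isLiftOfAut_absGaloisTransport_of_isImaginaryQuadratic hK hc1 hc₀
  have hinv : ∀ x, t (t x) = x := fun x ↦
    RatClosure.absGaloisTransport_absGaloisTransport_of_sq_eq_one hc₀.sq_eq_one x
  obtain ⟨g₁, eT, -, hγ₁⟩ := htarget ht hinv
  set θ := RatClosure.torsionEquiv (K := K) W ((p : ℕ) : ℤ) with hθ
  -- ### Step C: the finite exceptional set of places of `ℚ`
  set B : Finset ℕ := {p} ∪ (W.conductorNorm ℤ).primeFactors ∪ (NumberField.discr K).natAbs.primeFactors ∪ B₀ with hB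
  set S₁ : Set (HeightOneSpectrum (𝓞 ℚ)) := {v | ∃ q ∈ B, q.Prime ∧ (q : 𝓞 ℚ) ∈ v.asIdeal} with hS₁
  set S₂ : Set (HeightOneSpectrum (𝓞 ℚ)) := {v | ¬ Algebra.IsUnramifiedIn (𝓞 K) v.asIdeal} with hS₂
  have hS₁fin : S₁.Finite := by
    have : S₁ ⊆ ⋃ q ∈ (B.filter Nat.Prime), {v | (q : 𝓞 ℚ) ∈ v.asIdeal} := by
      intro v ⟨q, hqB, hq, hqv⟩
      simp only [Set.mem_iUnion, Finset.mem_filter]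
      exact ⟨q, ⟨hqB, hq⟩, hqv⟩
    refine Set.Finite.subset (Set.Finite.biUnion (Finset.finite_toSet _) fun q hq ↦ ?_) this
    rw [Finset.coe_filter, Set.mem_setOf_eq] at hq
    have hsub : {v : HeightOneSpectrum (𝓞 ℚ) | (q : 𝓞 ℚ) ∈ v.asIdeal}.Subsingleton :=
      fun v hv v' hv' ↦ HeightOneSpectrum.eq_of_natCast_mem_rat hq.2 hv hv'
    exact hsub.finite
  have hS₂fin : S₂.Finite := finite_setOf_not_isUnramifiedIn ℚ K
  set S := S₁ ∪ S₂ with hSdef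
  have hSfin : S.Finite := hS₁fin.union hS₂fin
  -- ### Step D: Čebotarev in `Γ_ℚ`: a Frobenius in the open set `c₀ · res(g₁ Γ_{K(E[p])})`
  set 𝒩 := torsionFixing (W.baseChange K) ((p : ℕ) : ℤ) with h𝒩
  have h𝒩open : IsOpen (𝒩 : Set (absoluteGaloisGroup K)) := isOpen_torsionFixing (W.baseChange K) hn0
  set O : Set (absoluteGaloisGroup ℚ) :=
    (fun γ ↦ c₀ * γ) '' (absGaloisRestrict ℚ K '' ((fun m ↦ g₁ * m) '' (𝒩 : Set _))) with hO
  have hOopen : IsOpen O := by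
    refine (Homeomorph.mulLeft c₀).isOpenMap _ (isOpenMap_absGaloisRestrict K _ ?_)
    exact (Homeomorph.mulLeft g₁).isOpenMap _ h𝒩open
  have hOne : O.Nonempty :=
    ⟨c₀ * absGaloisRestrict ℚ K (g₁ * 1), _, ⟨_, ⟨1, 𝒩.one_mem, rfl⟩, rfl⟩, rfl⟩
  obtain ⟨γ, hγO, v, hvS, 𝔓₀, h𝔓₀, hγ⟩ :=
    (absoluteGaloisGroup.frobenius_dense Literature.NumberTheory.Automorphic.chebotarev_artinRep_holds ℚ S
      hSfin).inter_open_nonempty O hOopen hOne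
  obtain ⟨_, ⟨_, ⟨m, hm, rfl⟩, rfl⟩, rfl⟩ := hγO
  set g := g₁ * m with hg
  have hsT : m ∈ torsionFixing (W.baseChange K) ((p : ℕ) : ℤ) := hm
  dsimp only at hγ
  -- ### Step E: the rational prime `ℓ` under `v`
  obtain ⟨ℓ, hℓ, hℓv⟩ := exists_prime_natCast_mem v
  have hℓB : ℓ ∉ B := fun h ↦ hvS (Or.inl ⟨ℓ, h, hℓ, hℓv⟩)
  simp only [hB, Finset.mem_union, Finset.mem_singleton, Nat.mem_primeFactors, not_or] at hℓB
  obtain ⟨⟨⟨hℓp, hℓN⟩, hℓD⟩, hℓB₀⟩ := hℓB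
  have hℓN' : ¬ ℓ ∣ W.conductorNorm ℤ := fun h ↦ hℓN ⟨hℓ, h, (W.conductorNorm_pos_holds).ne'⟩
  have hunr : Algebra.IsUnramifiedIn (𝓞 K) v.asIdeal := by
    by_contra h; exact hvS (Or.inr h)
  haveI : Fact ℓ.Prime := ⟨hℓ⟩
  have hℓp' : ℓ ≠ p := hℓp
  have hgoodℓ : W.HasGoodReductionAtPrime ℓ := by
    by_contra hbadℓ
    exact hℓN' ((W.dvd_conductorNorm_iff_not_hasGoodReductionAtPrime ℓ).mpr hbadℓ)
  have hvℓ : (primesEquiv v : ℕ) = ℓ := primesEquiv_eq_of_natCast_mem hℓ hℓv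
  -- ### Step F: `ℓ` is inert
  have hHi := index_range_absGaloisRestrict_eq_finrank ℚ K
  haveI hHn : ((absGaloisRestrict ℚ K).range).Normal :=
    Subgroup.normal_of_index_eq_two (hHi.trans hK.1)
  have hI := inertia_le_range_absGaloisRestrict_of_isUnramifiedIn (K := K) hunr h𝔓₀
  have hΦH : c₀ * absGaloisRestrict ℚ K g ∉ (absGaloisRestrict ℚ K).range := by
    intro h
    apply hc₀.not_mem_range_absGaloisRestrict (L := K) IsTotallyComplex.isComplex
    change c₀ ∈ ((absGaloisRestrict ℚ K).range : Set (absoluteGaloisGroup ℚ))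
    have h' : c₀ = c₀ * absGaloisRestrict ℚ K g * (absGaloisRestrict ℚ K g)⁻¹ := by group
    rw [SetLike.mem_coe, h']
    exact Subgroup.mul_mem _ h (Subgroup.inv_mem _ ⟨g, rfl⟩)
  obtain ⟨w, _𝔔, _τ', hwv, hwuniq, -, -, -, -, -⟩ :=
    exists_place_inert_of_not_mem_range (F := ℚ) (M := K) (hK.1 ▸ Nat.prime_two) hHn
      (hHi.trans rfl) hunr h𝔓₀ hI hγ hΦH
  have hℓw : (ℓ : 𝓞 K) ∈ w.asIdeal := by
    have h1 : (ℓ : 𝓞 ℚ) ∈ (w.under (𝓞 ℚ)).asIdeal := by rw [hwv]; exact hℓv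
    rw [HeightOneSpectrum.under_asIdeal, Ideal.under_def, Ideal.mem_comap, map_natCast] at h1
    exact h1
  have hwuniq' : ∀ w' : HeightOneSpectrum (𝓞 K), (ℓ : 𝓞 K) ∈ w'.asIdeal → w' = w := by
    intro w' hw'
    apply hwuniq
    apply HeightOneSpectrum.eq_of_natCast_mem_rat hℓ _ hℓv
    rw [HeightOneSpectrum.under_asIdeal, Ideal.under_def, Ideal.mem_comap, map_natCast]
    exact hw'
  have hspan : Ideal.span {(ℓ : 𝓞 K)} = w.asIdeal := by
    apply span_natCast_eq_of_unique hℓ w hwuniq'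
    haveI : w.asIdeal.LiesOver v.asIdeal := ⟨by rw [← hwv]; rfl⟩
    have hmap : v.asIdeal.map (algebraMap (𝓞 ℚ) (𝓞 K)) = Ideal.span {(ℓ : 𝓞 K)} := by
      rw [← span_natCast_rat_eq hℓ hℓv, Ideal.map_span, Set.image_singleton, map_natCast]
    have hne : v.asIdeal.map (algebraMap (𝓞 ℚ) (𝓞 K)) ≠ ⊥ := by
      rw [hmap, Ne, Ideal.span_singleton_eq_bot]; exact_mod_cast hℓ.ne_zero
    rw [← hmap, ← Ideal.IsDedekindDomain.ramificationIdx_eq_normalizedFactors_count v.asIdeal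
      w.asIdeal hne]
    exact Ideal.ramificationIdx_eq_one_iff.mpr (hunr w.asIdeal w.isPrime inferInstance)
  -- ### Step H: `γ = c₀ · res g` acts on `E(ℚ̄)[p]` as `D` (through `eT ∘ θ`); the congruences
  have hact : ∀ P : geomTorsion W ((p : ℕ) : ℤ),
      (θ.trans eT) ((c₀ * absGaloisRestrict ℚ K g) • P) =
        ![(ν : ZMod p) * (θ.trans eT) P 0, (ν : ZMod p) * 2 * (θ.trans eT) P 1] := fun P ↦ by
    have hresg : absGaloisRestrict ℚ K g = absGaloisRestrict ℚ K g₁ * absGaloisRestrict ℚ K m := by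
      change absGaloisRestrict ℚ K (g₁ * m) = _
      exact map_mul _ _ _
    rw [AddEquiv.trans_apply, AddEquiv.trans_apply, hresg, ← mul_assoc,
      mul_smul (c₀ * absGaloisRestrict ℚ K g₁) (absGaloisRestrict ℚ K m) P,
      absGaloisRestrict_smul_eq_of_mem_torsionFixing W hsT]
    exact hγ₁ P
  have hmod := isAdmissible_congruences_of_frob W h5 hℓp' hgoodℓ hvℓ h𝔓₀ hγ (θ.trans eT) hν hact
  have hsgn := dvd_signedCongruence_of_frob W hℓp' hgoodℓ hvℓ h𝔓₀ hγ (θ.trans eT) hν hact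
  have hℓpN : ¬ ℓ ∣ p * W.conductorNorm ℤ := by
    intro h
    rcases (Nat.Prime.dvd_mul hℓ).mp h with h' | h'
    · exact hℓp' ((Nat.prime_dvd_prime_iff_eq hℓ hp).mp h')
    · exact hℓN' h'
  exact ⟨ℓ, hℓB₀, ⟨hℓ, hℓpN, hspan ▸ w.isPrime, hmod.1, hmod.2⟩, hsgn⟩

end Cheb

/-! ## §3 (Sup±) on cell β — the text of `Signdetour.SignedSupplyAt`, unfolded -/

section Supply

variable (W : WeierstrassCurve ℚ) (K : Type) [Field K] [NumberField K] (p : ℕ) [W.IsElliptic] [W.IsGloballyMinimal]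
  [Fact p.Prime]

/-- **(Sup±) — the SIGNED SUPPLY of admissible primes on cell β, KERNEL** (`p ≥ 5`, `ρ̄_{E,p}` onto, `K` imaginary quadratic, `N_E` Heegner in `K`,
`p` SPLIT in `K`, `c ≠ 1`): for each sign `s` and each finite set `B₀` of Bertolini–Darmon admissible primes there is an admissible `q ∉ B₀` of
(Equiv)-sign `s` — complex conjugation acts on `H¹(K_v, E[p])`, `v ∣ q`, by `sgnP s`: `loc_v (c_* z) = sgnP s • loc_v z` for all `z ∈ H¹(K, E[p])`.
This is `Signdetour.SignedSupplyAt W K p c` of `Lines/admdef.lean` v9 UNFOLDED; it replaces the stub (Eig±) there.  Proof: §2 fed with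
`…AdmdefChebSplitTarget.exists_admissible_target_of_split` (`ν = sgnP s`), then `…AdmdefSignedEquiv.localEquiv_of_admQ_of_dvd`.
[cite: WZhang2014, Lemma 7.3, §9 (9.2)] [cite: BertoliniDarmon2005, Thm. 3.2] -/
theorem signedSupply_of_split (h5 : 5 ≤ p) (hsurj : W.HasSurjectiveModNGaloisRep p) (hK : IsImaginaryQuadratic K)
    (hH : SatisfiesHeegnerHypothesis (W.conductorNorm ℤ) K) (hsp : ((Ideal.span {(p : ℤ)}).primesOver (𝓞 K)).ncard = 2)
    {c : K ≃ₐ[ℚ] K} (hc1 : c ≠ 1) (s : Bool) (B₀ : Finset (AdmQ W K p)) :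
    ∃ q : AdmQ W K p, q ∉ B₀ ∧ ∀ v : HeightOneSpectrum (𝓞 K), ((q : ℕ) : 𝓞 K) ∈ v.asIdeal → ∀ z : Vp W K p,
      (W.baseChange K).torsionLocMap (v.adicCompletion K) ((p ^ 1 : ℕ) : ℤ) (conjAct W c ((p ^ 1 : ℕ) : ℤ) z) =
        sgnP s • (W.baseChange K).torsionLocMap (v.adicCompletion K) ((p ^ 1 : ℕ) : ℤ) z := by
  have hν : sgnP s = 1 ∨ sgnP s = -1 := by cases s <;> simp [sgnP]
  obtain ⟨q, hqB, hadm, hdvd⟩ := exists_admissible_dvd_of_target W K h5 hK hc1 hν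
    (fun ht hinv ↦ SignedBaseChangeAcDivAdmdefChebSplit.exists_admissible_target_of_split W K h5 hK hsurj hsp hH ht hinv hν)
    (B₀.image Subtype.val)
  refine ⟨⟨q, hadm⟩, fun hqn ↦ hqB (Finset.mem_image.mpr ⟨⟨q, hadm⟩, hqn, rfl⟩), ?_⟩
  exact SignedBaseChangeAcDivAdmdefSignedEquiv.localEquiv_of_admQ_of_dvd W K p hK.1 hc1 ⟨q, hadm⟩ s hdvd

end Supply

end Summit.BirchSwinnertonDyer.BirchSwinnertonDyer.Theorems.SignedBaseChangeAcDivAdmdefSignedSupply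

end
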